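import Literature.Barriers.CriticalPhenomena.RigorousRGSmallParameterHHWTaylorRecursion
import HarnessLib

/-!
# Newman's bound (A.6) along the trajectory and its uses (5.3), (5.5), (5.26) in HHW §5

Support file for the computer-aided half `HaraHattoriWatanabe2001_thm22` (HHW 2001, Theorem 2.2,
§5), after `RigorousRGSmallParameterHHWTaylorRecursion.lean` (the exact recursion (5.4), (5.6),
(5.7)). The truncation of Proposition 5.1 controls the untracked coefficients `a_{ℓ,N}`, `ℓ > M`,
by "the Newman inequalities (A.6)": `a_ℓ ≤ a_M a_{ℓ-M} ≤ a_M a_1^{ℓ-M}` ((5.19), (5.26)) and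
`a_n ≤ a_1ⁿ` ((5.3), hence (5.5) `b_n ≤ (c a_1/2)ⁿ`). This file

* vendors (A.6) = Proposition A.1 of HHW's Appendix A (proved there from the product (A.7),
  i.e. (A.1) = `HaraHattoriWatanabe2001_eqA1`, now a theorem of the tree, via the elementary
  symmetric sums (A.8)–(A.12)) as the named fact `HaraHattoriWatanabe2001_eqA6` — for the
  trajectory `traj s N`, `s ≥ 0`, with `a_{n,N} = HierarchicalRG.taylorA (traj s N) n`;
* PROVES from it: `taylorA_traj_le_pow` ((5.3) `a_n ≤ a_1ⁿ`), `taylorA_traj_le_mul_pow`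
  (`a_ℓ ≤ a_M a_1^{ℓ-M}`), `bOf_le_pow` ((5.5)) and `bOf_le_pow_mul` ((5.26),
  `b_j ≤ (c a_1/2)ʲ a_M/a_1^M` for `j > 2M`), with `taylorA_zero`, `taylorA_nonneg`.

Not here: the tail estimates (5.18)–(5.29) of Proposition 5.1 built on these, and the discharge of
(A.6) from `HaraHattoriWatanabe2001_eqA1_holds` (expansion of `∏(1 + H²/α_j²)`).

## References

* T. Hara, T. Hattori, H. Watanabe, Comm. Math. Phys. 220 (2001) 13–40, §5.1 eqs. (5.3), (5.5);
  §5.2 eqs. (5.19), (5.26); Appendix A, Proposition A.1, eqs. (A.6)–(A.12).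
* C. M. Newman, Comm. Math. Phys. 41 (1975) 1–9, Theorem 6 (the bounds `v_{4n} ≤ v_4ⁿ` etc.).
-/

noncomputable section

namespace Literature.Barriers.CriticalPhenomena

open _root_.MeasureTheory _root_.ProbabilityTheory _root_.Filter _root_.Set _root_.Finset
open scoped _root_.Topology _root_.ENNReal _root_.NNReal BigOperators

/-- NAMED FACT — **HHW Appendix A, Proposition A.1, eq. (A.6) (Newman's bound), along the
trajectory.** "Put `a_N = N!/(2N)! · E[X^{2N}]`, `N ∈ ℤ₊`. Then `a_{M+N} ≤ a_M a_N`,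
`N, M = 0, 1, 2, ⋯`" for a stochastic variable `X` in Newman's class `𝓛` — here `X ~ h_N = R^N h_{I,s}`
(`s ≥ 0`), which is in the class by (2.9) (`hasLeeYangProperty_traj`) and (A.1)
(`HaraHattoriWatanabe2001_eqA1_holds`); HHW prove (A.6) from the product (A.7) = (A.1) via the
expansion (A.8)–(A.12) (`c_{n+m} ≤ c_n c_m` for the elementary symmetric sums of the `α_j⁻²`).
With `a_{n,N} = taylorA h_N n` ((5.1)). Its special case `a_n ≤ a_1ⁿ` is (5.3)
(`taylorA_traj_le_pow`, proved from this fact). Users take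
`(h : HaraHattoriWatanabe2001_eqA6)`. [cite: HaraHattoriWatanabe2001, Appendix A, Proposition A.1 eq. (A.6)]
[cite: Newman1975, Theorem 6] -/
def HaraHattoriWatanabe2001_eqA6 : Prop :=
  ∀ s : ℝ, 0 ≤ s → ∀ N m n : ℕ,
    HierarchicalRG.taylorA (HierarchicalRG.traj s N) (m + n) ≤
      HierarchicalRG.taylorA (HierarchicalRG.traj s N) m * HierarchicalRG.taylorA (HierarchicalRG.traj s N) n

namespace HierarchicalRG

/-- `a_0 = 1` for a probability law. [cite: HaraHattoriWatanabe2001, §5.1 (p. 15, `a_{0,N} = ĥ_N(0) = 1`)] -/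
theorem taylorA_zero (ν : Measure ℝ) [IsProbabilityMeasure ν] : taylorA ν 0 = 1 := by
  simp [taylorA, moment_id_eq]

/-- `a_n ≥ 0` (even moments are non-negative). [cite: HaraHattoriWatanabe2001, §5.1 (p. 15, `a_{n,N} ≥ 0`)] -/
theorem taylorA_nonneg (ν : Measure ℝ) (n : ℕ) : 0 ≤ taylorA ν n := by
  rw [taylorA, moment_id_eq]
  refine mul_nonneg (by positivity) (integral_nonneg fun x => ?_)
  rw [pow_mul]; positivity

/-- **(5.3) from (A.6)**: `a_{n,N} ≤ a_{1,N}ⁿ`. [cite: HaraHattoriWatanabe2001, §5.1 eq. (5.3)] -/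
theorem taylorA_traj_le_pow (h : HaraHattoriWatanabe2001_eqA6) {s : ℝ} (hs : 0 ≤ s) (N : ℕ) :
    ∀ n : ℕ, taylorA (traj s N) n ≤ taylorA (traj s N) 1 ^ n
  | 0 => by rw [taylorA_zero, pow_zero]
  | n + 1 => by
    calc taylorA (traj s N) (n + 1) ≤ taylorA (traj s N) n * taylorA (traj s N) 1 := h s hs N n 1
      _ ≤ taylorA (traj s N) 1 ^ n * taylorA (traj s N) 1 :=
          mul_le_mul_of_nonneg_right (taylorA_traj_le_pow h hs N n) (taylorA_nonneg _ _)
      _ = taylorA (traj s N) 1 ^ (n + 1) := by rw [pow_succ]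

/-- For `ℓ ≥ M`: `a_ℓ ≤ a_M a_1^{ℓ-M}` ((A.6) with (5.3), as used in (5.19)).
[cite: HaraHattoriWatanabe2001, §5.2 eq. (5.19)] -/
theorem taylorA_traj_le_mul_pow (h : HaraHattoriWatanabe2001_eqA6) {s : ℝ} (hs : 0 ≤ s) (N : ℕ)
    {M l : ℕ} (hl : M ≤ l) :
    taylorA (traj s N) l ≤ taylorA (traj s N) M * taylorA (traj s N) 1 ^ (l - M) := by
  obtain ⟨k, rfl⟩ := Nat.exists_eq_add_of_le hl
  rw [Nat.add_sub_cancel_left]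
  exact (h s hs N M k).trans (mul_le_mul_of_nonneg_left (taylorA_traj_le_pow h hs N k)
    (taylorA_nonneg _ _))

/-- **(5.5): `b_n ≤ (c a_1/2)ⁿ`** (`c = √2`). [cite: HaraHattoriWatanabe2001, §5.1 eq. (5.5)] -/
theorem bOf_le_pow (h : HaraHattoriWatanabe2001_eqA6) {s : ℝ} (hs : 0 ≤ s) (N n : ℕ) :
    bOf (fun l => taylorA (traj s N) l) n ≤ (Real.sqrt 2 * taylorA (traj s N) 1 / 2) ^ n := by
  unfold bOf
  set a := fun l => taylorA (traj s N) l with ha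
  have hterm : ∀ l ∈ Finset.range (n + 1), (n.choose l : ℝ) * a l * a (n - l) ≤ (n.choose l : ℝ) * a 1 ^ n := by
    intro l hl
    have hln : l ≤ n := Nat.lt_succ_iff.1 (Finset.mem_range.1 hl)
    rw [mul_assoc]
    refine mul_le_mul_of_nonneg_left ?_ (Nat.cast_nonneg _)
    calc a l * a (n - l) ≤ a 1 ^ l * a 1 ^ (n - l) :=
          mul_le_mul (taylorA_traj_le_pow h hs N l) (taylorA_traj_le_pow h hs N (n - l))
            (taylorA_nonneg _ _) (pow_nonneg (taylorA_nonneg _ _) _)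
      _ = a 1 ^ n := by rw [← pow_add, Nat.add_sub_cancel' hln]
  calc (Real.sqrt 2 / 4) ^ n * ∑ l ∈ Finset.range (n + 1), (n.choose l : ℝ) * a l * a (n - l)
      ≤ (Real.sqrt 2 / 4) ^ n * ∑ l ∈ Finset.range (n + 1), (n.choose l : ℝ) * a 1 ^ n :=
        mul_le_mul_of_nonneg_left (Finset.sum_le_sum hterm) (by positivity)
    _ = (Real.sqrt 2 * a 1 / 2) ^ n := by
        rw [← Finset.sum_mul, show (∑ l ∈ Finset.range (n + 1), (n.choose l : ℝ)) = 2 ^ n from by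
          exact_mod_cast Nat.sum_range_choose n]
        rw [div_pow, div_pow, mul_pow, show (4 : ℝ) ^ n = 2 ^ n * 2 ^ n by rw [← mul_pow]; norm_num]
        field_simp

/-- **(5.26): `b_j ≤ (c a_1/2)ʲ · a_M/a_1^M` for `j > 2M`** (each product `a_ℓ a_{j-ℓ}` has a
factor of index `> M`). [cite: HaraHattoriWatanabe2001, §5.2 eq. (5.26)] -/
theorem bOf_le_pow_mul (h : HaraHattoriWatanabe2001_eqA6) {s : ℝ} (hs : 0 ≤ s) (N : ℕ) {M j : ℕ}
    (hj : 2 * M < j) (ha1 : 0 < taylorA (traj s N) 1) :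
    bOf (fun l => taylorA (traj s N) l) j ≤
      (Real.sqrt 2 * taylorA (traj s N) 1 / 2) ^ j * (taylorA (traj s N) M / taylorA (traj s N) 1 ^ M) := by
  unfold bOf
  set a := fun l => taylorA (traj s N) l with ha
  have hM : ∀ l ∈ Finset.range (j + 1), (j.choose l : ℝ) * a l * a (j - l) ≤
      (j.choose l : ℝ) * (a M * a 1 ^ (j - M)) := by
    intro l hl
    have hlj : l ≤ j := Nat.lt_succ_iff.1 (Finset.mem_range.1 hl)
    rw [mul_assoc]
    refine mul_le_mul_of_nonneg_left ?_ (Nat.cast_nonneg _)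
    rcases le_or_gt l M with hlM | hlM
    · -- `j - l > M`
      have hjl : M ≤ j - l := by omega
      calc a l * a (j - l) ≤ a 1 ^ l * (a M * a 1 ^ (j - l - M)) :=
            mul_le_mul (taylorA_traj_le_pow h hs N l) (taylorA_traj_le_mul_pow h hs N hjl)
              (taylorA_nonneg _ _) (pow_nonneg (taylorA_nonneg _ _) _)
        _ = a M * a 1 ^ (j - M) := by
            rw [mul_left_comm, ← pow_add, show l + (j - l - M) = j - M by omega]
    · have hlM' : M ≤ l := hlM.le
      calc a l * a (j - l) ≤ (a M * a 1 ^ (l - M)) * a 1 ^ (j - l) :=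
            mul_le_mul (taylorA_traj_le_mul_pow h hs N hlM') (taylorA_traj_le_pow h hs N (j - l))
              (taylorA_nonneg _ _) (mul_nonneg (taylorA_nonneg _ _) (pow_nonneg (taylorA_nonneg _ _) _))
        _ = a M * a 1 ^ (j - M) := by
            rw [mul_assoc, ← pow_add, show l - M + (j - l) = j - M by omega]
  have hsum := Finset.sum_le_sum hM
  rw [← Finset.sum_mul, show (∑ l ∈ Finset.range (j + 1), (j.choose l : ℝ)) = 2 ^ j from by
    exact_mod_cast Nat.sum_range_choose j] at hsum
  have hMj : M ≤ j := by omega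
  calc (Real.sqrt 2 / 4) ^ j * ∑ l ∈ Finset.range (j + 1), (j.choose l : ℝ) * a l * a (j - l)
      ≤ (Real.sqrt 2 / 4) ^ j * (2 ^ j * (a M * a 1 ^ (j - M))) :=
        mul_le_mul_of_nonneg_left hsum (by positivity)
    _ = (Real.sqrt 2 * a 1 / 2) ^ j * (a M / a 1 ^ M) := by
        have : a 1 ^ j = a 1 ^ (j - M) * a 1 ^ M := by rw [← pow_add, Nat.sub_add_cancel hMj]
        have hpow : a 1 ^ M ≠ 0 := pow_ne_zero _ ha1.ne'
        rw [div_pow, div_pow, mul_pow, this, show (4 : ℝ) ^ j = 2 ^ j * 2 ^ j by rw [← mul_pow]; norm_num]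
        field_simp

end HierarchicalRG

end Literature.Barriers.CriticalPhenomena

end
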